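import Summits.CriticalPhenomena.PercolationContinuityZ3.Theorems.PercNonProliferationSubpolynomialBlockingStubSixSlab
import Summits.CriticalPhenomena.PercolationContinuityZ3.Theorems.PercNonProliferationSubpolynomialBlockingStubTiling
import HarnessLib

/-!
# Crux `PercNonProliferation.SubpolynomialBlocking` (stmt-CriticalPhenomena-4446), line `cross-sandwich-flat-seal` — stub `stub_cruxOfComparisonOfAnchor`

Helper file for the crux skeleton `Cruxes/SubpolynomialBlocking/Lines/cross_sandwich_flat_seal.lean`
(lead prover-line-stmt-CriticalPhenomena-4446-0). Proves exactly the registered stub signature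
`stub_cruxOfComparisonOfAnchor`; lands with `--supports stmt-CriticalPhenomena-4446`.

## The statement (THE LINE'S COMPOSITION AS A TREE THEOREM)

COMPARISON ∧ ANCHOR ⇒ CRUX. With
`q_n = P_{p_c}([0,n]³ sealed between {x₀=0} and {x₀=n})` and
`seed_k(n) = P_{p_c}([0,n] × [0,n+⌊n/k⌋]² sealed between {x₀=0} and {x₀=n})`:
if (comparison, "RSW for plaquettes by an inch") `∃ k ≥ 1, ∃ C, ∃ c > 0, ∀ᶠ n, c · q_n^C ≤ seed_k(n)` and
(anchor) `∀ s > 0, ∀ᶠ n, n^{-s} ≤ q_n`, then the crux holds, stated in its landed parametrised form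
`Negative.SubpolynomialBlockingAt 3 p_c` (which IS the route decl: `Negative.crux_iff = Iff.rfl`).
These two hypotheses are the line's two OPEN registered stubs (`stub_comparison`, `stub_anchor`); if the
planner promotes them to items, this theorem is their assembly.

## The argument

`n^{-t} ≤ q_n` for all small `t` ⇒ `c q_n^C ≥ c n^{-tC} ≥ n^{-s'}` eventually ⇒ `seed_k(n)` is sub-polynomial ⇒
`V_n ≥ seed_k(n)^K` (`stub_tiling`) and `u_n ≥ V_n⁶` (`stub_sixSlab`) are sub-polynomial: fixed powers and positive
constants are absorbed by the `∀ s` quantifier (`exists_eventually_rpow_le`).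
-/

noncomputable section

namespace Summit.CriticalPhenomena.PercolationContinuityZ3.Theorems.SubpolynomialBlocking

open MeasureTheory Filter Topology
open Literature.Probability.Percolation Literature.Probability.LatticeModels
open Summit.CriticalPhenomena.PercolationContinuityZ3.Theorems.SubpolynomialBlocking.Negative

namespace StubCruxOfComparisonOfAnchor

/-- For `s > 0`, `c > 0` and a fixed power `M` there is `t > 0` with `n^{-s} ≤ c · (n^{-t})^M` for all large `n`
(`t = s / (2(M+1))`): polynomial powers and positive constants are invisible at the scale `n^{-o(1)}`. -/
theorem exists_eventually_rpow_le {s c : ℝ} (hs : 0 < s) (hc : 0 < c) (M : ℕ) :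
    ∃ t : ℝ, 0 < t ∧ ∀ᶠ n : ℕ in atTop, (n : ℝ) ^ (-s) ≤ c * ((n : ℝ) ^ (-t)) ^ M := by
  refine ⟨s / (2 * (M + 1)), by positivity, ?_⟩
  have h1 : ∀ᶠ n : ℕ in atTop, (n : ℝ) ^ (-(s / 2)) < c :=
    ((tendsto_rpow_neg_atTop (by positivity : 0 < s / 2)).comp tendsto_natCast_atTop_atTop).eventually
      (gt_mem_nhds hc)
  filter_upwards [h1, eventually_ge_atTop 1] with n h1 hn
  have hn1 : (1 : ℝ) ≤ n := by exact_mod_cast hn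
  have hn0 : (0 : ℝ) < n := by linarith
  rw [← Real.rpow_natCast, ← Real.rpow_mul hn0.le]
  have hsplit : (n : ℝ) ^ (-s) = (n : ℝ) ^ (-(s / 2)) * (n : ℝ) ^ (-(s / 2)) := by
    rw [← Real.rpow_add hn0]; ring_nf
  rw [hsplit]
  refine mul_le_mul h1.le ?_ (Real.rpow_nonneg hn0.le _) hc.le
  refine Real.rpow_le_rpow_of_exponent_le hn1 ?_
  have hM : (0 : ℝ) ≤ M := by positivity
  have hM1 : (0 : ℝ) < 2 * (M + 1) := by positivity
  have key : s / (2 * (M + 1)) * M ≤ s / 2 := by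
    rw [div_mul_eq_mul_div, div_le_div_iff₀ hM1 two_pos]
    nlinarith
  linarith

/-- A sub-polynomial lower bound survives a positive constant and a fixed power: if `a_n ≥ n^{-t}` eventually
for every `t > 0`, `c > 0`, and `b_n ≥ c · a_n ^ M` eventually, then `b_n ≥ n^{-s}` eventually for every `s > 0`. -/
theorem subpoly_of_const_mul_pow_le {a b : ℕ → ℝ} {c : ℝ} (hc : 0 < c) (M : ℕ)
    (ha : ∀ t : ℝ, 0 < t → ∀ᶠ n : ℕ in atTop, (n : ℝ) ^ (-t) ≤ a n)
    (hab : ∀ᶠ n : ℕ in atTop, c * a n ^ M ≤ b n) :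
    ∀ s : ℝ, 0 < s → ∀ᶠ n : ℕ in atTop, (n : ℝ) ^ (-s) ≤ b n := by
  intro s hs
  obtain ⟨t, ht, hev⟩ := exists_eventually_rpow_le hs hc M
  filter_upwards [hev, ha t ht, hab] with n h1 h2 h3
  have h0 : (0 : ℝ) ≤ (n : ℝ) ^ (-t) := Real.rpow_nonneg (Nat.cast_nonneg n) _
  calc (n : ℝ) ^ (-s) ≤ c * ((n : ℝ) ^ (-t)) ^ M := h1
    _ ≤ c * a n ^ M := mul_le_mul_of_nonneg_left (pow_le_pow_left₀ h0 h2 M) hc.le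
    _ ≤ b n := h3

end StubCruxOfComparisonOfAnchor

open StubCruxOfComparisonOfAnchor in
/-- **Registered stub `stub_cruxOfComparisonOfAnchor`** (crux stmt-CriticalPhenomena-4446, line `cross-sandwich-flat-seal`):
COMPARISON (`∃ k ≥ 1, ∃ C, ∃ c > 0, ∀ᶠ n, c·q_n^C ≤ seed_k(n)`) and ANCHOR (`∀ s > 0, ∀ᶠ n, n^{-s} ≤ q_n`) imply the
crux in its landed form `Negative.SubpolynomialBlockingAt 3 p_c` (= `PercNonProliferation.SubpolynomialBlocking` by
`Negative.crux_iff`, `Iff.rfl`) — via `stub_tiling` (`seed^K ≤ V`) and `stub_sixSlab` (`V⁶ ≤ u`). -/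
theorem stub_cruxOfComparisonOfAnchor :
    (∃ k : ℕ, 1 ≤ k ∧ ∃ (C : ℕ) (c : ℝ), 0 < c ∧ ∀ᶠ n : ℕ in atTop,
      c * (bondPercolation (zdGraph 3) (criticalProbI 3)).real
          (openCrossing (Set.Icc (0 : Site 3) ![(n : ℤ), (n : ℤ), (n : ℤ)])
            {x | x ∈ Set.Icc (0 : Site 3) ![(n : ℤ), (n : ℤ), (n : ℤ)] ∧ x 0 = 0}
            {y | y ∈ Set.Icc (0 : Site 3) ![(n : ℤ), (n : ℤ), (n : ℤ)] ∧ y 0 = (n : ℤ)})ᶜ ^ C ≤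
        (bondPercolation (zdGraph 3) (criticalProbI 3)).real
          (openCrossing (Set.Icc (0 : Site 3) ![(n : ℤ), (n : ℤ) + (n / k : ℕ), (n : ℤ) + (n / k : ℕ)])
            {x | x ∈ Set.Icc (0 : Site 3) ![(n : ℤ), (n : ℤ) + (n / k : ℕ), (n : ℤ) + (n / k : ℕ)] ∧ x 0 = 0}
            {y | y ∈ Set.Icc (0 : Site 3) ![(n : ℤ), (n : ℤ) + (n / k : ℕ), (n : ℤ) + (n / k : ℕ)] ∧
              y 0 = (n : ℤ)})ᶜ) →
    (∀ s : ℝ, 0 < s → ∀ᶠ n : ℕ in atTop,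
      (n : ℝ) ^ (-s) ≤
        (bondPercolation (zdGraph 3) (criticalProbI 3)).real
          (openCrossing (Set.Icc (0 : Site 3) ![(n : ℤ), (n : ℤ), (n : ℤ)])
            {x | x ∈ Set.Icc (0 : Site 3) ![(n : ℤ), (n : ℤ), (n : ℤ)] ∧ x 0 = 0}
            {y | y ∈ Set.Icc (0 : Site 3) ![(n : ℤ), (n : ℤ), (n : ℤ)] ∧ y 0 = (n : ℤ)})ᶜ) →
    SubpolynomialBlockingAt 3 (criticalProbI 3) := by
  rintro ⟨k, hk, C, c, hc, hcmp⟩ hA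
  rw [subpolynomialBlockingAt_iff]
  obtain ⟨K, N, hKN⟩ := stub_tiling k hk
  -- seed_k is sub-polynomial
  have hseed := subpoly_of_const_mul_pow_le hc C hA hcmp
  -- V is sub-polynomial (`seed^K ≤ V`, constant 1)
  have hV : ∀ t : ℝ, 0 < t → ∀ᶠ n : ℕ in atTop, (n : ℝ) ^ (-t) ≤
      (bondPercolation (zdGraph 3) (criticalProbI 3)).real
        (openCrossing (Set.Icc (![(n : ℤ), -(2 * (n : ℤ)), -(2 * (n : ℤ))] : Site 3)
            ![2 * (n : ℤ), 2 * (n : ℤ), 2 * (n : ℤ)])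
          {x | x ∈ Set.Icc (![(n : ℤ), -(2 * (n : ℤ)), -(2 * (n : ℤ))] : Site 3)
            ![2 * (n : ℤ), 2 * (n : ℤ), 2 * (n : ℤ)] ∧ x 0 = (n : ℤ)}
          {y | y ∈ Set.Icc (![(n : ℤ), -(2 * (n : ℤ)), -(2 * (n : ℤ))] : Site 3)
            ![2 * (n : ℤ), 2 * (n : ℤ), 2 * (n : ℤ)] ∧ y 0 = 2 * (n : ℤ)})ᶜ := by
    refine subpoly_of_const_mul_pow_le one_pos K hseed ?_
    filter_upwards [eventually_ge_atTop N] with n hn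
    rw [one_mul]
    exact hKN n hn
  -- u is sub-polynomial (`V⁶ ≤ u`)
  have hu := subpoly_of_const_mul_pow_le one_pos 6 hV
    (b := fun n => blockProb 3 (criticalProbI 3) n) (by
      filter_upwards [eventually_ge_atTop 1] with n hn
      rw [one_mul]
      exact stub_sixSlab n hn)
  exact hu

end Summit.CriticalPhenomena.PercolationContinuityZ3.Theorems.SubpolynomialBlocking

end
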